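import Summits.QuantumAdvantage.AdviceFreeQNC0.SumCodeDualWords
import HarnessLib

/-!
# Cell qa-qnc0 (rung F-Q1, density axis, crux of record `TensorMultOneAt` = MULT₁): the TENSOR face of the
# fence "LP never pays" — weights of dual words of the `k`-block sum code, and the ceiling on packings

Second half of the kernel form of FENCE L24-A (qn-lit g12, `HOME/qa-qnc0-lit/LIT-MEMO-19.md` §2; blockwise
duality, single-block weights and fibres are in `SumCodeDualWords.lean`).  A FRACTIONAL PACKING `y ≥ 0` of
odd dual words `a` of the sum code (`IsSumCodeDual n k t a`, `|a|` odd) with pointwise load `Σ_{a ∋ u} y_a ≤ 1`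
certifies `failCount win ≥ Σ_a y_a` for every `win ∈ SumCodeWin n k t` ("LP peeling", ROUND-12 §2.7, is the
case of product packings).  PROVED here:

* **TENSOR** (`SumCodeDual.two_pow_le_card_of_isSumCodeDual`, `SumCodeDual.odd_card_ge_of_isSumCodeDual`):
  a nonempty dual word of the `k`-block sum code at block degree `t` has `≥ 2^{(t+1)k}` points, an odd one
  `≥ 3·2^t·2^{(t+1)(k−1)}` — induction on the set of blocks (`two_pow_le_card_of_isDualFor`,
  `odd_card_ge_of_isDualFor`): the block-`j` fibre of `A` through a point is block-`j`-dual, the block-`j`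
  co-fibres are dual for the remaining blocks and pairwise disjoint, an odd `A` has an odd fibre
  (the product-code bound `d(A ⊗ B) ≥ d(A)·d(B)` in the cell's coordinates);
* **packings certify** (`SumCodeDual.packing_le_failCount`): `Σ_a y_a ≤ failCount win` for every sum-code
  pattern `win` (each odd dual word meets each fail set, `failCount_pos_of_oddDual`);
* **LP CEILING** (`SumCodeDual.packing_le`): `(Σ_a y_a)·3·2^t·2^{(t+1)(k−1)} ≤ 2ⁿ` (double counting).  At
  `n = m·k`: `Σ_a y_a ≤ (2/3)·(2^m/2^{t+1})^k`, so the ratio per block any packing / peeling certificate can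
  give to `TensorMultAt m t β` is `β ≤ 2^{-(t+1)}·(2/3)^{1/k} < NEED_t = 2^{-(t+1)}`: the LP road is closed as
  a PAYOFF route at every block degree and every tensor level (it remains the source of RUNGS — prover seat
  qa-qnc0-prover's `TensorLPNorm.lean` / `TensorLPInduction.lean`).

Companion fences: the GLOBAL face (degree-`D` walk code: `WalkDualSupport`, planner qa-qnc0-p2 ROUND-8 §2.3,
`ExactHit.lean`) and the parity-blind face (McEliece–Posner: transversals of box powers converge to the LP;
LIT-MEMO-19 §3, Duchet, Handbook of Combinatorics vol. 1 ch. 7, Cor. 4.26 — literature, not formalised).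
WHAT THIS IS NOT: no statement about `TensorMultOneAt` / MULT₁ itself (OPEN) — the fence bounds a CLASS OF
CERTIFICATES, not the fail count; nothing on crux α; separation NOT moved.
-/

namespace Summit.QuantumAdvantage.AdviceFreeQNC0

open Finset
open Literature.Computability.MetaComplexity Literature.Computability.MetaComplexity.Smolensky

variable {n : ℕ}

namespace SumCodeDual

/-! ### The tensor bound: induction on the set of blocks -/

/-- One induction step: if every nonempty set dual for the blocks in `J` has `≥ d` points, then a set
dual for `insert j J` (`j ∉ J`) contains, for every point `u₀`, at least `|fibre of u₀| · d` points —
the block-`j` co-fibres through the points of the block-`j` fibre of `u₀` are pairwise disjoint, dual for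
`J`, and nonempty. -/
theorem fibre_mul_le_card {k t j : ℕ} {J : Finset ℕ} (hj : j ∉ J) {d : ℕ}
    (hd : ∀ B : Finset (Fin n → Bool), IsDualFor n k t J B → B.Nonempty → d ≤ B.card)
    {A : Finset (Fin n → Bool)} (hA : IsDualFor n k t (insert j J) A) (u₀ : Fin n → Bool) :
    (A.filter fun u => offPart n k j u = offPart n k j u₀).card * d ≤ A.card := by
  classical
  set F := A.filter fun u => offPart n k j u = offPart n k j u₀ with hF
  -- the co-fibres
  let G : (Fin n → Bool) → Finset (Fin n → Bool) :=
    fun u => A.filter fun w => decide (onPart n k j w = onPart n k j u) = true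
  have hGdual : ∀ u, IsDualFor n k t J (G u) := by
    intro u j' hj'
    have hne' : j ≠ j' := fun h => hj (h ▸ hj')
    exact isBlockDual_filter (hA j' (mem_insert_of_mem hj')) _
      (fun v w => by simp only [onPart_mergeBlock_ne hne'])
  have hGcard : ∀ u ∈ F, d ≤ (G u).card := fun u hu =>
    hd (G u) (hGdual u) ⟨u, by simp [G, (mem_filter.1 hu).1]⟩
  have hdisj : (F : Set (Fin n → Bool)).PairwiseDisjoint G := by
    intro u hu u' hu' hne
    rw [Function.onFun, Finset.disjoint_left]
    intro w hw hw'
    apply hne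
    have h1 := (mem_filter.1 hw).2
    have h2 := (mem_filter.1 hw').2
    have hu1 := (mem_filter.1 (Finset.mem_coe.1 hu)).2
    have hu2 := (mem_filter.1 (Finset.mem_coe.1 hu')).2
    simp only [decide_eq_true_eq] at h1 h2
    exact eq_of_parts_eq (hu1.trans hu2.symm) (h1.symm.trans h2)
  have hunion : F.biUnion G ⊆ A := by
    intro w hw
    obtain ⟨u, _, hw⟩ := mem_biUnion.1 hw
    exact (mem_filter.1 hw).1
  calc F.card * d = ∑ _u ∈ F, d := by rw [sum_const, smul_eq_mul]
    _ ≤ ∑ u ∈ F, (G u).card := sum_le_sum hGcard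
    _ = (F.biUnion G).card := (card_biUnion hdisj).symm
    _ ≤ A.card := card_le_card hunion

/-- **Nonzero dual words for a block set `J` have `≥ 2^{(t+1)|J|}` points.** -/
theorem two_pow_le_card_of_isDualFor (k t : ℕ) :
    ∀ (J : Finset ℕ) (A : Finset (Fin n → Bool)),
      IsDualFor n k t J A → A.Nonempty → 2 ^ ((t + 1) * J.card) ≤ A.card := by
  classical
  intro J
  induction J using Finset.induction_on with
  | empty =>
    intro A _ hne
    simpa using card_pos.2 hne
  | insert j J hj ih =>
    intro A hA hne
    obtain ⟨u₀, hu₀⟩ := hne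
    have hAj : IsBlockDual n k j t A := hA j (mem_insert_self j J)
    have hF := two_pow_succ_le_card (isBlockDual_fibre hAj u₀) ⟨u₀, mem_filter.2 ⟨hu₀, rfl⟩⟩
    have hstep := fibre_mul_le_card (n := n) hj ih hA u₀
    calc 2 ^ ((t + 1) * (insert j J).card)
        = 2 ^ (t + 1) * 2 ^ ((t + 1) * J.card) := by
          rw [card_insert_of_notMem hj, Nat.mul_succ, pow_add, mul_comm]
      _ ≤ (A.filter fun u => offPart n k j u = offPart n k j u₀).card * 2 ^ ((t + 1) * J.card) :=
          Nat.mul_le_mul_right _ hF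
      _ ≤ A.card := hstep

/-- An odd set has an odd fibre along block `j`. -/
theorem exists_odd_fibre (k j : ℕ) {A : Finset (Fin n → Bool)} (hodd : A.card % 2 = 1) :
    ∃ u₀ ∈ A, (A.filter fun u => offPart n k j u = offPart n k j u₀).card % 2 = 1 := by
  classical
  by_contra hall
  have hall' : ∀ u₀ ∈ A, (A.filter fun u => offPart n k j u = offPart n k j u₀).card % 2 ≠ 1 :=
    fun u₀ hu₀ hc => hall ⟨u₀, hu₀, hc⟩
  have hsum := Finset.card_eq_sum_card_fiberwise (f := offPart n k j) (s := A)
    (t := A.image (offPart n k j)) (fun u hu => by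
      simp only [Finset.coe_image]
      exact Set.mem_image_of_mem _ hu)
  have heven : ∀ c ∈ A.image (offPart n k j),
      (A.filter fun u => offPart n k j u = c).card % 2 = 0 := by
    intro c hc
    obtain ⟨u, hu, rfl⟩ := mem_image.1 hc
    have := hall' u hu
    omega
  have hmod : A.card % 2 = 0 := by
    rw [hsum, Finset.sum_nat_mod, Finset.sum_congr rfl heven]
    simp
  omega

/-- **Odd dual words for a block set `insert j J` (`j ∉ J`) have `≥ 3·2^t·2^{(t+1)|J|}` points.** -/
theorem odd_card_ge_of_isDualFor {k t j : ℕ} {J : Finset ℕ} (hj : j ∉ J)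
    {A : Finset (Fin n → Bool)} (hA : IsDualFor n k t (insert j J) A) (hodd : A.card % 2 = 1) :
    3 * 2 ^ t * 2 ^ ((t + 1) * J.card) ≤ A.card := by
  classical
  obtain ⟨u₀, _, hFodd⟩ := exists_odd_fibre k j hodd
  have hAj : IsBlockDual n k j t A := hA j (mem_insert_self j J)
  have hF := three_mul_two_pow_le_card (isBlockDual_fibre hAj u₀) hFodd
  have hstep := fibre_mul_le_card (n := n) hj
    (fun B hB hBne => two_pow_le_card_of_isDualFor k t J B hB hBne) hA u₀
  calc 3 * 2 ^ t * 2 ^ ((t + 1) * J.card)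
      ≤ (A.filter fun u => offPart n k j u = offPart n k j u₀).card * 2 ^ ((t + 1) * J.card) :=
        Nat.mul_le_mul_right _ hF
    _ ≤ A.card := hstep

/-! ### The `k`-block sum code -/

/-- **Nonzero dual words of the `k`-block sum code at block degree `t` have `≥ 2^{(t+1)k}` points.** -/
theorem two_pow_le_card_of_isSumCodeDual {k t : ℕ} {A : Finset (Fin n → Bool)}
    (hA : IsSumCodeDual n k t A) (hne : A.Nonempty) : 2 ^ ((t + 1) * k) ≤ A.card := by
  simpa [card_range] using two_pow_le_card_of_isDualFor k t (range k) A (isDualFor_range hA) hne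

/-- **Odd dual words of the `k`-block sum code at block degree `t` (`k ≥ 1`) have
`≥ 3·2^t·2^{(t+1)(k−1)}` points** — the tensor face of FENCE L24-A. -/
theorem odd_card_ge_of_isSumCodeDual {k t : ℕ} (hk : 0 < k) {A : Finset (Fin n → Bool)}
    (hA : IsSumCodeDual n k t A) (hodd : A.card % 2 = 1) :
    3 * 2 ^ t * 2 ^ ((t + 1) * (k - 1)) ≤ A.card := by
  obtain ⟨k', rfl⟩ : ∃ k', k = k' + 1 := ⟨k - 1, by omega⟩
  have hrange : range (k' + 1) = insert k' (range k') := by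
    ext x; simp only [mem_range, mem_insert]; omega
  have hdual : IsDualFor n (k' + 1) t (insert k' (range k')) A := by
    rw [← hrange]; exact isDualFor_range hA
  have h := odd_card_ge_of_isDualFor (notMem_range_self) hdual hodd
  simpa [card_range] using h

/-! ### The LP ceiling -/

/-- **LP CEILING (FENCE L24-A, kernel form).** A fractional packing `y ≥ 0` of odd dual words of the
`k`-block sum code (`k ≥ 1`) with pointwise load `Σ_{a ∋ u} y_a ≤ 1` has total value
`Σ_a y_a ≤ 2ⁿ / (3·2^t·2^{(t+1)(k−1)})`.  At `n = m·k`: `Σ_a y_a ≤ (2/3)·(2^m / 2^{t+1})^k`, i.e. the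
certified ratio per block is `≤ 2^{-(t+1)}·(2/3)^{1/k} < NEED_t`. -/
theorem packing_le {k t : ℕ} (hk : 0 < k) (cert : Finset (Finset (Fin n → Bool)))
    (y : Finset (Fin n → Bool) → ℝ) (hy : ∀ a ∈ cert, 0 ≤ y a)
    (hdual : ∀ a ∈ cert, IsSumCodeDual n k t a ∧ a.card % 2 = 1)
    (hload : ∀ u : Fin n → Bool, ∑ a ∈ cert.filter (fun a => u ∈ a), y a ≤ 1) :
    (∑ a ∈ cert, y a) * ((3 * 2 ^ t * 2 ^ ((t + 1) * (k - 1)) : ℕ) : ℝ) ≤ (2 : ℝ) ^ n := by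
  classical
  set d : ℕ := 3 * 2 ^ t * 2 ^ ((t + 1) * (k - 1)) with hd
  have hcard : ∀ a ∈ cert, (d : ℝ) ≤ (a.card : ℝ) := fun a ha => by
    exact_mod_cast odd_card_ge_of_isSumCodeDual hk (hdual a ha).1 (hdual a ha).2
  calc (∑ a ∈ cert, y a) * (d : ℝ)
      = ∑ a ∈ cert, y a * d := sum_mul _ _ _
    _ ≤ ∑ a ∈ cert, y a * a.card := sum_le_sum fun a ha => mul_le_mul_of_nonneg_left (hcard a ha) (hy a ha)
    _ = ∑ a ∈ cert, ∑ _u ∈ a, y a := by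
        refine sum_congr rfl fun a _ => ?_
        rw [sum_const, nsmul_eq_mul, mul_comm]
    _ = ∑ a ∈ cert, ∑ u : Fin n → Bool, if u ∈ a then y a else 0 := by
        refine sum_congr rfl fun a _ => ?_
        rw [← sum_filter]
        congr 1
        ext u; simp
    _ = ∑ u : Fin n → Bool, ∑ a ∈ cert, if u ∈ a then y a else 0 := sum_comm
    _ = ∑ u : Fin n → Bool, ∑ a ∈ cert.filter (fun a => u ∈ a), y a := by
        refine sum_congr rfl fun u _ => ?_
        rw [sum_filter]
    _ ≤ ∑ _u : Fin n → Bool, (1 : ℝ) := sum_le_sum fun u _ => hload u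
    _ = (2 : ℝ) ^ n := by
        rw [sum_const, card_univ, nsmul_eq_mul, mul_one]
        have hc : Fintype.card (Fin n → Bool) = 2 ^ n := by
          rw [Fintype.card_fun, Fintype.card_bool, Fintype.card_fin]
        rw [hc]
        push_cast
        ring

/-- The same ceiling with the failure set made explicit: a packing certificate is a lower bound for
`failCount win` for EVERY `win ∈ SumCodeWin n k t` (each odd dual word meets each fail set), and that
lower bound never exceeds `2ⁿ / (3·2^t·2^{(t+1)(k−1)})`.  (The first half — "packings certify" — is the
one-line parity count recorded here for completeness.) -/
theorem failCount_pos_of_oddDual {k t : ℕ} {a : Finset (Fin n → Bool)} (ha : IsSumCodeDual n k t a)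
    (hodd : a.card % 2 = 1) {win : (Fin n → Bool) → Bool} (hwin : SumCodeWin n k t win) :
    (a.filter fun u => win u = false).Nonempty := by
  classical
  have heven := ha win hwin
  have hsplit := Finset.card_filter_add_card_filter_not (s := a) (fun u => win u = true)
  have hset : (a.filter fun u => ¬ win u = true) = a.filter fun u => win u = false := by
    ext u; simp
  rw [hset] at hsplit
  rw [Finset.nonempty_iff_ne_empty]
  intro hempty
  rw [hempty, card_empty, add_zero] at hsplit
  omega

/-- **Packings certify.** A fractional packing of odd dual words of the sum code (pointwise load `≤ 1`)
is a lower bound for the fail count of EVERY pattern of the sum code: each odd dual word meets each fail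
set (`failCount_pos_of_oddDual`), so `Σ_a y_a ≤ Σ_a y_a·|a ∩ FAIL| = Σ_{u ∈ FAIL} load(u) ≤ #FAIL`.  Together
with `packing_le`: LP certificates for `TensorMult`/`TensorMultAt` exist at every level and are ALL worth
`≤ 2ⁿ/(3·2^t·2^{(t+1)(k−1)})`. -/
theorem packing_le_failCount {k t : ℕ} (cert : Finset (Finset (Fin n → Bool)))
    (y : Finset (Fin n → Bool) → ℝ) (hy : ∀ a ∈ cert, 0 ≤ y a)
    (hdual : ∀ a ∈ cert, IsSumCodeDual n k t a ∧ a.card % 2 = 1)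
    (hload : ∀ u : Fin n → Bool, ∑ a ∈ cert.filter (fun a => u ∈ a), y a ≤ 1)
    {win : (Fin n → Bool) → Bool} (hwin : SumCodeWin n k t win) :
    ∑ a ∈ cert, y a ≤ (failCount win : ℝ) := by
  classical
  set FAIL := (univ.filter fun u : Fin n → Bool => win u = false) with hFAIL
  have hmeet : ∀ a ∈ cert, (1 : ℝ) ≤ ((a.filter fun u => win u = false).card : ℝ) := fun a ha => by
    have h := failCount_pos_of_oddDual (hdual a ha).1 (hdual a ha).2 hwin
    exact_mod_cast Finset.one_le_card.2 h
  calc ∑ a ∈ cert, y a = ∑ a ∈ cert, y a * 1 := by simp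
    _ ≤ ∑ a ∈ cert, y a * ((a.filter fun u => win u = false).card : ℝ) :=
        sum_le_sum fun a ha => mul_le_mul_of_nonneg_left (hmeet a ha) (hy a ha)
    _ = ∑ a ∈ cert, ∑ _u ∈ a.filter (fun u => win u = false), y a := by
        refine sum_congr rfl fun a _ => ?_
        rw [sum_const, nsmul_eq_mul, mul_comm]
    _ = ∑ a ∈ cert, ∑ u ∈ FAIL, if u ∈ a then y a else 0 := by
        refine sum_congr rfl fun a _ => ?_
        rw [← sum_filter]
        congr 1
        ext u
        simp [hFAIL, and_comm]
    _ = ∑ u ∈ FAIL, ∑ a ∈ cert, if u ∈ a then y a else 0 := sum_comm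
    _ = ∑ u ∈ FAIL, ∑ a ∈ cert.filter (fun a => u ∈ a), y a := by
        refine sum_congr rfl fun u _ => ?_
        rw [sum_filter]
    _ ≤ ∑ _u ∈ FAIL, (1 : ℝ) := sum_le_sum fun u _ => hload u
    _ = (failCount win : ℝ) := by
        rw [sum_const, nsmul_eq_mul, mul_one, hFAIL]
        rfl

end SumCodeDual

end Summit.QuantumAdvantage.AdviceFreeQNC0
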